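import Mathlib
import Summits.PneNP.PneNP.Theorems.Nc03AvoidResidualCoreReductionFcycB

/-!
# Route Nc03AvoidResidualCore, item `ResidualCoreReduction` — greedy cycle packing

Helper file for `stmt-PneNP-20227` (sequel of `…ReductionFcycB`; cell pnp-ideate). The greedy
packing of an edge set `E` of a bipartite multigraph: while `E` has an edge outside its BFS forest,
take the least such edge, remove its fundamental cycle, repeat. `packUnion E` is the union of the
removed cycles and `packCol E` the union of their alternating patterns. We prove: `packUnion E ⊆ E`
carries the balanced pattern `packCol E`; the leftover `E \ packUnion E` is contained in its own BFS
forest, so has at most `|W|` edges; and if every vertex has even degree in `E` then nothing is left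
over (a nonempty sub-forest has a vertex of degree one). Consequently every edge set contains an
even-degree ("Eulerian") subset missing at most `|W|` edges. [folklore]
-/

set_option linter.dupNamespace false -- `Summit.PneNP.PneNP.…`: summit = sub-problem name (D-0017 single-conjunct layout)

namespace Summit.PneNP.PneNP.Theorems.Nc03Reduction

open Finset

namespace Bip

variable {ι W : Type*} (G : Bip ι W) [LinearOrder W] [Fintype W] [LinearOrder ι] [Inhabited ι]

noncomputable section
open Classical

/-- The edges of `E` outside its BFS forest. -/
def nonForest (E : Finset ι) : Finset ι := E \ G.forest E

/-- The seed of the next cycle: the least non-forest edge (junk if there is none). -/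
def seed (E : Finset ι) : ι := if h : (G.nonForest E).Nonempty then (G.nonForest E).min' h else default

/-- The seed of a packable set is a non-forest edge of it. -/
theorem seed_spec {E : Finset ι} (h : (G.nonForest E).Nonempty) :
    G.seed E ∈ E ∧ G.seed E ∉ G.forest E := by
  have hs : G.seed E = (G.nonForest E).min' h := by unfold seed; rw [dif_pos h]
  have hm := Finset.min'_mem _ h
  rw [← hs] at hm
  exact Finset.mem_sdiff.1 hm

/-- Removing the seed's fundamental cycle shrinks the set. -/
theorem card_sdiff_fcycle_lt {E : Finset ι} (h : (G.nonForest E).Nonempty) :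
    (E \ G.fcycle E (G.seed E)).card < E.card := by
  obtain ⟨he, -⟩ := G.seed_spec h
  apply Finset.card_lt_card
  exact Finset.sdiff_ssubset (G.fcycle_subset he) ⟨_, G.self_mem_fcycle he⟩

/-- The union of the cycles of the greedy packing of `E`. -/
def packUnion (E : Finset ι) : Finset ι :=
  if _ : (G.nonForest E).Nonempty then
    G.fcycle E (G.seed E) ∪ packUnion (E \ G.fcycle E (G.seed E))
  else ∅
termination_by E.card
decreasing_by exact G.card_sdiff_fcycle_lt (by assumption)

/-- The union of the alternating patterns of the cycles of the greedy packing of `E`. -/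
def packCol (E : Finset ι) : ι → Bool :=
  if _ : (G.nonForest E).Nonempty then
    fun j => if j ∈ G.fcycle E (G.seed E) then G.fcol E (G.seed E) j
      else packCol (E \ G.fcycle E (G.seed E)) j
  else fun _ => false
termination_by E.card
decreasing_by exact G.card_sdiff_fcycle_lt (by assumption)

/-- Unfolding the packing union in the packable case. -/
theorem packUnion_of_nonempty {E : Finset ι} (h : (G.nonForest E).Nonempty) :
    G.packUnion E = G.fcycle E (G.seed E) ∪ G.packUnion (E \ G.fcycle E (G.seed E)) := by
  rw [packUnion, dif_pos h]

/-- Unfolding the packing union in the terminal case. -/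
theorem packUnion_of_empty {E : Finset ι} (h : ¬ (G.nonForest E).Nonempty) : G.packUnion E = ∅ := by
  rw [packUnion, dif_neg h]

/-- Unfolding the packing pattern in the packable case. -/
theorem packCol_of_nonempty {E : Finset ι} (h : (G.nonForest E).Nonempty) (j : ι) :
    G.packCol E j = if j ∈ G.fcycle E (G.seed E) then G.fcol E (G.seed E) j
      else G.packCol (E \ G.fcycle E (G.seed E)) j := by
  rw [packCol, dif_pos h]

/-- Unfolding the packing pattern in the terminal case. -/
theorem packCol_of_empty {E : Finset ι} (h : ¬ (G.nonForest E).Nonempty) (j : ι) :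
    G.packCol E j = false := by
  rw [packCol, dif_neg h]

/-- **Packing invariants.** The packing union lies in `E`, carries the balanced pattern `packCol E`
(which is supported on it), and the leftover has no non-forest edge. -/
theorem pack_spec : ∀ (n : ℕ) (E : Finset ι), E.card = n →
    G.packUnion E ⊆ E ∧ G.Bal (G.packUnion E) (G.packCol E) ∧
      (∀ j, G.packCol E j = true → j ∈ G.packUnion E) ∧
      G.nonForest (E \ G.packUnion E) = ∅ := by
  intro n
  induction n using Nat.strong_induction_on with
  | _ n ih =>
    intro E hE
    by_cases h : (G.nonForest E).Nonempty
    · obtain ⟨he, heT⟩ := G.seed_spec h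
      set Z := G.fcycle E (G.seed E) with hZ
      obtain ⟨ih1, ih2, ih3, ih4⟩ := ih _ (by rw [← hE]; exact G.card_sdiff_fcycle_lt h) (E \ Z) rfl
      have hU := G.packUnion_of_nonempty h
      have hC := G.packCol_of_nonempty h
      rw [← hZ] at hU hC
      have hdisj : Disjoint Z (G.packUnion (E \ Z)) :=
        Finset.disjoint_left.2 fun j hjZ hjU => (Finset.mem_sdiff.1 (ih1 hjU)).2 hjZ
      refine ⟨?_, ?_, ?_, ?_⟩
      · rw [hU]
        exact Finset.union_subset (G.fcycle_subset he) (ih1.trans Finset.sdiff_subset)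
      · rw [hU]
        have hb1 : G.Bal Z (G.packCol E) := by
          refine Bal.congr G (G.bal_fcycle he heT) fun j hj => ?_
          rw [hC, if_pos hj]
        have hb2 : G.Bal (G.packUnion (E \ Z)) (G.packCol E) := by
          refine Bal.congr G ih2 fun j hj => ?_
          rw [hC, if_neg (Finset.disjoint_right.1 hdisj hj)]
        convert Bal.union G hb1 hb2 hdisj using 3
      · intro j hj
        rw [hC] at hj
        rw [hU, Finset.mem_union]
        by_cases hjZ : j ∈ Z
        · exact Or.inl hjZ
        · rw [if_neg hjZ] at hj; exact Or.inr (ih3 j hj)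
      · rw [hU]
        have : E \ (Z ∪ G.packUnion (E \ Z)) = (E \ Z) \ G.packUnion (E \ Z) := by
          ext j; simp only [Finset.mem_sdiff, Finset.mem_union, not_or]; tauto
        rw [this]; exact ih4
    · have hU := G.packUnion_of_empty h
      refine ⟨by rw [hU]; exact Finset.empty_subset _, by rw [hU]; exact G.bal_empty _,
        fun j hj => ?_, ?_⟩
      · rw [G.packCol_of_empty h] at hj; exact Bool.noConfusion hj
      · rw [hU, Finset.sdiff_empty]; exact Finset.not_nonempty_iff_eq_empty.1 h

/-- The packing union lies in `E`. -/
theorem packUnion_subset (E : Finset ι) : G.packUnion E ⊆ E := (G.pack_spec _ E rfl).1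

/-- The packing pattern is balanced on the packing union. -/
theorem bal_packUnion (E : Finset ι) : G.Bal (G.packUnion E) (G.packCol E) := (G.pack_spec _ E rfl).2.1

/-- The packing pattern is supported on the packing union. -/
theorem mem_packUnion_of_packCol {E : Finset ι} {j : ι} (h : G.packCol E j = true) :
    j ∈ G.packUnion E :=
  (G.pack_spec _ E rfl).2.2.1 j h

/-- The leftover of the packing lies in its own BFS forest. -/
theorem leftover_subset_forest (E : Finset ι) :
    E \ G.packUnion E ⊆ G.forest (E \ G.packUnion E) := by
  intro j hj
  by_contra hjT
  have : j ∈ G.nonForest (E \ G.packUnion E) := Finset.mem_sdiff.2 ⟨hj, hjT⟩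
  rw [(G.pack_spec _ E rfl).2.2.2] at this
  exact Finset.notMem_empty _ this

/-- The packing union misses at most `|W|` edges of `E`. -/
theorem card_le_packUnion (E : Finset ι) : E.card ≤ (G.packUnion E).card + Fintype.card W := by
  have h1 : (E \ G.packUnion E).card ≤ Fintype.card W :=
    (Finset.card_le_card (G.leftover_subset_forest E)).trans (G.card_forest_le _)
  have h2 := Finset.card_sdiff_add_card_eq_card (G.packUnion_subset E)
  omega

/-- **A sub-forest with even degrees is empty**: a nonempty edge set contained in its own BFS
forest has a vertex of degree one (the child end of a deepest edge). -/
theorem eq_empty_of_forest_even {L : Finset ι} (hL : L ⊆ G.forest L)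
    (hA : ∀ a, Even (L.filter fun j => G.eA j = a).card)
    (hB : ∀ b, Even (L.filter fun j => G.eB j = b).card) : L = ∅ := by
  by_contra hne
  obtain ⟨j₀, hj₀, hmax⟩ := Finset.exists_max_image L (fun j => G.depth L (G.deep L j))
    (Finset.nonempty_iff_ne_empty.2 hne)
  set w := G.deep L j₀ with hw
  obtain ⟨hpos, hpe⟩ := G.forest_eq_pe_deep (hL hj₀)
  rw [← hw] at hpos hpe
  -- every edge of `L` at `w` is `j₀`
  have key : ∀ j ∈ L, w ∈ G.ends j → j = j₀ := by
    intro j hj hwj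
    obtain ⟨hxpos, hxpe⟩ := G.forest_eq_pe_deep (hL hj)
    have hends := G.ends_pe hxpos
    rw [hxpe] at hends
    rw [hends, Finset.mem_insert, Finset.mem_singleton] at hwj
    rcases hwj with hwj | hwj
    · rw [← hpe, hwj, hxpe]
    · have h1 := G.depth_parent hxpos
      have h2 := hmax j hj
      rw [← hwj] at h1
      omega
  have hwends : w ∈ G.ends j₀ := by rw [← hpe]; exact G.mem_ends_pe hpos
  rcases G.mem_ends.1 hwends with hwA | hwB
  · have : (L.filter fun j => G.eA j = w) = {j₀} := by
      ext j
      simp only [Finset.mem_filter, Finset.mem_singleton]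
      constructor
      · rintro ⟨hj, hja⟩; exact key j hj (hja ▸ G.eA_mem_ends j)
      · rintro rfl; exact ⟨hj₀, hwA.symm⟩
    have h := hA w
    rw [this, Finset.card_singleton] at h
    exact Nat.not_even_one h
  · have : (L.filter fun j => G.eB j = w) = {j₀} := by
      ext j
      simp only [Finset.mem_filter, Finset.mem_singleton]
      constructor
      · rintro ⟨hj, hjb⟩; exact key j hj (hjb ▸ G.eB_mem_ends j)
      · rintro rfl; exact ⟨hj₀, hwB.symm⟩
    have h := hB w
    rw [this, Finset.card_singleton] at h
    exact Nat.not_even_one h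

omit [LinearOrder W] [Fintype W] [Inhabited ι] in
/-- Degrees in a difference by a subset. -/
theorem card_filter_sdiff {S T : Finset ι} (hTS : T ⊆ S) (p : ι → Prop) [DecidablePred p] :
    ((S \ T).filter p).card + (T.filter p).card = (S.filter p).card := by
  have h1 : (S \ T).filter p = S.filter p \ T.filter p := by
    ext j; simp only [Finset.mem_filter, Finset.mem_sdiff]; tauto
  rw [h1]
  exact Finset.card_sdiff_add_card_eq_card (Finset.filter_subset_filter p hTS)

/-- **Even-degree sets are fully packed.** -/
theorem packUnion_eq_of_even (E : Finset ι)
    (hA : ∀ a, Even (E.filter fun j => G.eA j = a).card)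
    (hB : ∀ b, Even (E.filter fun j => G.eB j = b).card) : G.packUnion E = E := by
  have hsub := G.packUnion_subset E
  have hbal := G.bal_packUnion E
  have hLA : ∀ a, Even ((E \ G.packUnion E).filter fun j => G.eA j = a).card := by
    intro a
    have h1 := card_filter_sdiff hsub (fun j => G.eA j = a)
    have h2 := Bal.even_degA G hbal a
    have h3 := hA a
    rw [← h1] at h3
    exact (Nat.even_add.1 h3).2 h2
  have hLB : ∀ b, Even ((E \ G.packUnion E).filter fun j => G.eB j = b).card := by
    intro b
    have h1 := card_filter_sdiff hsub (fun j => G.eB j = b)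
    have h2 := Bal.even_degB G hbal b
    have h3 := hB b
    rw [← h1] at h3
    exact (Nat.even_add.1 h3).2 h2
  have hempty := G.eq_empty_of_forest_even (G.leftover_subset_forest E) hLA hLB
  exact Finset.Subset.antisymm hsub (Finset.sdiff_eq_empty_iff_subset.1 hempty)

/-- **Every edge set has an even-degree subset missing at most `|W|` edges.** -/
theorem exists_even_sub (E : Finset ι) : ∃ P ⊆ E,
    (∀ a, Even (P.filter fun j => G.eA j = a).card) ∧ (∀ b, Even (P.filter fun j => G.eB j = b).card) ∧
      E.card ≤ P.card + Fintype.card W :=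
  ⟨G.packUnion E, G.packUnion_subset E, fun a => Bal.even_degA G (G.bal_packUnion E) a,
    fun b => Bal.even_degB G (G.bal_packUnion E) b, G.card_le_packUnion E⟩

end

end Bip

end Summit.PneNP.PneNP.Theorems.Nc03Reduction
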